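import Literature.IUT.HodgeTheaters.ProfiniteCompletionNormalizers
import Literature.GroupTheory.FreeGroupProfiniteCompletionSlim
import Literature.GroupTheory.CombinatorialGroupTheory.FreeGroupCompletionTorsionFree
import Mathlib.Data.ZMod.Basic
import HarnessLib

/-!
# The centraliser of a free normal subgroup of finite index in the profinite completion

Topic `Literature/GroupTheory` (abc-iut cell, campaign-L residual «J2», [AbsTopIII] Lemma 4.3 as used in
the proof of Prop. 4.2 (i), kurims p. 106: "the id-rigidity … follows immediately from the slimness
assertion of Lemma 4.3" — read by abc-iut-L4-t14 as ONE statement about the profinite completion of the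
normaliser `M = N(Γ̄)` of the uniformising Fuchsian group `Γ̄`: every element of `M̂` commuting with the
image `η(Γ̄)` is trivial, `LocObj.isIdRigid_of_completion_normalizer`).

PROOF-ONLY file (no definition, no named fact).  **Main theorem** (`eq_one_of_forall_commute_toCompletion`):
let `M` be a group and `Λ ⊴ M` a NORMAL subgroup of FINITE INDEX which is a FREE group, with trivial
centraliser `C_M(Λ) = 1`; then every `y` in the profinite completion `M̂` commuting with `η(Λ)` is
trivial.  Equivalently `C_{M̂}(Λ̂) = 1` for the closure `Λ̂` of `η(Λ)` (with the tree's slimness of `Λ̂`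
and the extension step `IsSlimGroup.of_normal_of_centralizer_eq_bot` of `SlimNormalExtension.lean` this
gives the SLIMNESS of `M̂` — recorded in the companion `FreeNormalSubgroupCompletionSlim.lean`).

The proof is unconditional and uses only material already in the tree:
* the CENTRALISER CONDITION `C_{M̂}(η g) = closure (η C_M(g))` for `g` in a finite-index free subgroup
  (`centralizer_toCompletion_eq_closure_of_isFreeGroup'`, abc-iut-L5-d2 over Stebe's conjugacy
  separability of free groups, proved in the tree by abc-iut-L5-t14);
* the comparison `Λ̂ ≅ closure η(Λ) ⊆ M̂` (`exists_comparison`, abc-iut-L5-t17), slimness of the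
  completion of a nonabelian free group (`isSlimGroup_profiniteCompletion_of_isFreeGroup`), its
  torsion-freeness (`IsFreeGroup.eq_one_of_pow_eq_one_profiniteCompletion`) and residual finiteness;
* `C_Λ(x) = ⟨x⟩` for a basis element `x` (`centralizer_eq_zpowers_of_not_isPower`).
Argument: write `y = η(m)·k₀` with `k₀ ∈ Λ̂`; if `m ∈ Λ` then `y ∈ Λ̂ ∩ C(Λ̂) = Z(Λ̂) = 1`.  Otherwise let
`o` be the order of `m` modulo `Λ`; `y^o ∈ Λ̂ ∩ C(Λ̂)` so `y^o = 1`.  For a basis element `x ∈ Λ` the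
centraliser condition gives `y = η(a)·k` with `a ∈ C_M(x)`, `a ≡ m (mod Λ)`, `k ∈ Λ̂` commuting with
`η(a)`; hence `k^o = η(a)^{-o}` and `a^o ∈ C_Λ(x) = ⟨x⟩`, `a^o = x^j`.  Reading `k^o = η(x)^{-j}` through
`Λ̂ → Λ/Λ_x ≅ ℤ/o` (`x ↦ 1`) forces `o ∣ j`, so `e := a·x^{-j/o} ≡ m (mod Λ)` has finite order.  Finally
`y = η(e)·k'`, `k' ∈ Λ̂`, and conjugation by `η(e)` agrees with conjugation by `k'⁻¹` on `Λ̂`; iterating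
`ord(e)` times, `k'^{ord e}` is central in `Λ̂`, hence trivial, hence `k' = 1` (torsion-freeness), so
`η(e)` centralises `η(Λ)`, i.e. `e ∈ C_M(Λ) = 1` — contradicting `e ∉ Λ`.

Consequence (companion file): the hypothesis `h` of abc-iut-L4-t14's
`LocObj.isIdRigid_of_completion_normalizer` / `HolRS.isIdRigid_mapsTo_pslQuotient_of_centralizer` holds
for every subgroup `Γ ≤ N` that is free, of finite index in its normaliser, with
`C_N(Γ) ∩ N_N(Γ) = 1`.  What is NOT here: the index `[N_{PSL₂(ℝ)}(Γ̄) : Γ̄] < ∞` and the freeness of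
torsion-free non-cocompact Fuchsian groups (campaign-L inputs), and the cocompact (surface-group) case.

Classical group theory; OUR kernel check; nothing here bears on [IUTchIII] Cor. 3.12 or takes a side.
-/

noncomputable section

namespace Literature.GroupTheory

open Literature.AlgebraicGeometry.Frobenioids (IsSlimGroup)
open Literature.IUT.HodgeTheaters (profiniteCompletion toCompletion)
open Literature.IUT.HodgeTheaters.ProfiniteCompletion
open CategoryTheory ProfiniteGrp ProfiniteGrp.ProfiniteCompletion
open _root_.Topology

universe u

/-! ### The closure `Λ̂` of `η(Λ)` in `M̂` for a normal subgroup `Λ` of finite index -/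

section FreeNormal

variable {M : Type u} [Group M]

/-- For a finite-index normal subgroup `Λ ⊴ M`, the closure of `η(Λ)` in `M̂` is the kernel of the
coordinate projection `M̂ → M ⧸ Λ`. [cite: RibesZalesskii2010, §3.2] -/
theorem mem_closure_image_iff_val_eq_one (Λ : Subgroup M) [Λ.Normal] [Λ.FiniteIndex]
    (x : profiniteCompletion M) :
    x ∈ closure (toCompletion M '' (Λ : Set M)) ↔
      (x.val (FiniteIndexNormalSubgroup.ofSubgroup Λ) : M ⧸ Λ) = 1 := by
  refine (mem_closure_image_iff_val_mem (H := Λ) (FiniteIndexNormalSubgroup.ofSubgroup Λ)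
    le_rfl x).trans ⟨?_, fun h => ⟨1, Λ.one_mem, ?_⟩⟩
  · rintro ⟨l, hl, hlx⟩
    change (QuotientGroup.mk l : M ⧸ Λ) = _ at hlx
    rw [← hlx]
    exact (QuotientGroup.eq_one_iff l).mpr hl
  · change (QuotientGroup.mk (1 : M) : M ⧸ Λ) = _
    rw [QuotientGroup.mk_one]
    exact h.symm

/-- An element of `M̂` commuting with `η(S)` commutes with the closure of `η(S)`.
[cite: RibesZalesskii2010, §3.2] -/
theorem commute_of_mem_closure {S : Set M} {y : profiniteCompletion M}
    (hy : ∀ s ∈ S, y * toCompletion M s = toCompletion M s * y)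
    {k : profiniteCompletion M} (hk : k ∈ closure (toCompletion M '' S)) : y * k = k * y := by
  have hcl : IsClosed {k : profiniteCompletion M | y * k = k * y} :=
    isClosed_eq (continuous_const.mul continuous_id) (continuous_id.mul continuous_const)
  exact hcl.closure_subset_iff.mpr (by rintro _ ⟨s, hs, rfl⟩; exact hy s hs) hk

/-- **`Z_{M̂}(η Λ) ∩ Λ̂ = 1`**: for `Λ ≤ M` of finite index and free nonabelian, an element of the
closure `Λ̂` of `η(Λ)` commuting with `η(Λ)` is trivial — it corresponds under the comparison
`Λ̂ ≅ closure η(Λ)` to a central element of the slim group `Λ̂`.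
[cite: MochizukiAbsAnab2004, Lemma 1.3.1 p.15] -/
theorem eq_one_of_mem_closure_of_forall_commute (Λ : Subgroup M) [Λ.FiniteIndex] [IsFreeGroup Λ]
    (hΛ : ∃ a b : Λ, a * b ≠ b * a) {k : profiniteCompletion M}
    (hk : k ∈ closure (toCompletion M '' (Λ : Set M)))
    (hcomm : ∀ l ∈ Λ, k * toCompletion M l = toCompletion M l * k) : k = 1 := by
  obtain ⟨ι, -, hιi, hιη, hιr⟩ := exists_comparison Λ
  obtain ⟨z, rfl⟩ : k ∈ Set.range ι := by rw [hιr]; exact hk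
  suffices hz : z = 1 by rw [hz, map_one]
  have h1 : ∀ l : Λ, z * toCompletion Λ l = toCompletion Λ l * z := fun l =>
    hιi (by rw [map_mul, map_mul, hιη]; exact hcomm l l.2)
  have h2 : ∀ w : profiniteCompletion Λ, w * z = z * w := fun w =>
    (denseRange (GrpCat.of Λ)).induction_on w
      (isClosed_eq (continuous_id.mul continuous_const) (continuous_const.mul continuous_id))
      (fun l => (h1 l).symm)
  have hslim := isSlimGroup_profiniteCompletion_of_isFreeGroup hΛ
  have hz : z ∈ Subgroup.centralizer ((⊤ : Subgroup (profiniteCompletion Λ)) : Set _) := by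
    rw [Subgroup.mem_centralizer_iff]
    exact fun w _ => h2 w
  have htop : IsOpen ((⊤ : Subgroup (profiniteCompletion Λ)) : Set (profiniteCompletion Λ)) := by
    rw [Subgroup.coe_top]; exact isOpen_univ
  rwa [hslim.centralizer_eq_bot ⊤ htop, Subgroup.mem_bot] at hz

/-- **`Λ̂` is torsion-free**: for `Λ ≤ M` of finite index and free, an element of finite order of
the closure of `η(Λ)` is trivial (the tree's torsion-freeness of the completion of a free group,
through the comparison). [cite: RibesZalesskii2010, §3.2] -/
theorem eq_one_of_mem_closure_of_pow_eq_one (Λ : Subgroup M) [Λ.FiniteIndex] [IsFreeGroup Λ]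
    {k : profiniteCompletion M} (hk : k ∈ closure (toCompletion M '' (Λ : Set M)))
    {n : ℕ} (hn : 0 < n) (h : k ^ n = 1) : k = 1 := by
  obtain ⟨ι, -, hιi, -, hιr⟩ := exists_comparison Λ
  obtain ⟨z, rfl⟩ : k ∈ Set.range ι := by rw [hιr]; exact hk
  have hz : z ^ n = 1 := hιi (by rw [map_pow, h, map_one])
  rw [IsFreeGroup.eq_one_of_pow_eq_one_profiniteCompletion z hn hz, map_one]

/-- **`η_M` is injective on a finite-index free subgroup** (free groups are residually finite, and the
comparison `Λ̂ → M̂` is injective). [cite: RibesZalesskii2010, §3.2] -/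
theorem eq_one_of_toCompletion_eq_one (Λ : Subgroup M) [Λ.FiniteIndex] [IsFreeGroup Λ]
    {l : M} (hl : l ∈ Λ) (h : toCompletion M l = 1) : l = 1 := by
  obtain ⟨ι, -, hιi, hιη, -⟩ := exists_comparison Λ
  have h1 : toCompletion Λ ⟨l, hl⟩ = 1 := hιi (by rw [hιη, map_one]; exact h)
  haveI := Literature.IUT.HodgeTheaters.FreeOrSurface.residuallyFinite_of_isFreeGroup (Λ : Type u)
  have h2 : Function.Injective (etaFn (GrpCat.of (Λ : Type u))) :=
    (etaFn_injective_iff_residuallyFinite (GrpCat.of (Λ : Type u))).mpr inferInstance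
  have h3 : (⟨l, hl⟩ : Λ) = 1 := h2 (h1.trans (map_one (toCompletion Λ)).symm)
  exact congrArg Subtype.val h3

/-- **Finite quotients of `Λ` read on `Λ̂ ⊆ M̂`**: for a homomorphism `f : Λ → Q` to a finite group and
`k` in the closure of `η(Λ)` with `k ^ n = η(l)`, `l ∈ Λ`, the value `f l` is an `n`-th power in `Q`
(namely of `f̂ z`, `z ↦ k` under the comparison, `f̂` the extension of `f` to `Λ̂`).
[cite: RibesZalesskii2010, §3.2] -/
theorem exists_pow_eq_of_mem_closure_of_pow_eq (Λ : Subgroup M) [Λ.FiniteIndex]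
    {Q : Type*} [Group Q] [Finite Q] (f : Λ →* Q)
    {k : profiniteCompletion M} (hk : k ∈ closure (toCompletion M '' (Λ : Set M)))
    {n : ℕ} {l : M} (hl : l ∈ Λ) (h : k ^ n = toCompletion M l) : ∃ q : Q, q ^ n = f ⟨l, hl⟩ := by
  obtain ⟨ι, -, hιi, hιη, hιr⟩ := exists_comparison Λ
  obtain ⟨z, rfl⟩ : k ∈ Set.range ι := by rw [hιr]; exact hk
  obtain ⟨fhat, hfhat, -, -⟩ := exists_lift_of_finite f
  have hz : z ^ n = toCompletion Λ ⟨l, hl⟩ := hιi (by rw [map_pow, h, hιη])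
  exact ⟨fhat z, by rw [← map_pow, hz, hfhat]⟩

/-- A nontrivial free group has a basis element, and with it homomorphisms onto `ℤ` and onto every
`Multiplicative (ZMod o)` sending it to the generator; its centraliser is the cyclic group it
generates. [cite: Mochizuki2012, Lem 2.7(iv) p.57] -/
theorem exists_basis_element (L : Type u) [Group L] [IsFreeGroup L] (hL : ∃ g : L, g ≠ 1) (o : ℕ) :
    ∃ x : L, Subgroup.centralizer ({x} : Set L) = Subgroup.zpowers x ∧
      ∃ f : L →* Multiplicative (ZMod o), f x = Multiplicative.ofAdd 1 := by
  classical
  obtain ⟨g, hg⟩ := hL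
  -- a generator occurring in `g`
  have hne : (IsFreeGroup.toFreeGroup L g).toWord ≠ [] := by
    intro hnil
    apply hg
    have : IsFreeGroup.toFreeGroup L g = 1 := (FreeGroup.toWord_eq_nil_iff).mp hnil
    exact (MulEquiv.map_eq_one_iff _).mp this
  obtain ⟨⟨i, b⟩, -⟩ := List.exists_mem_of_ne_nil _ hne
  refine ⟨IsFreeGroup.of i, ?_, ?_⟩
  · refine centralizer_eq_zpowers_of_not_isPower (not_isPower_of_map_eq_ofAdd_one
      (IsFreeGroup.lift fun j => if j = i then Multiplicative.ofAdd (1 : ℤ) else 1) ?_)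
    rw [IsFreeGroup.lift_of, if_pos rfl]
  · refine ⟨IsFreeGroup.lift fun j => if j = i then Multiplicative.ofAdd (1 : ZMod o) else 1, ?_⟩
    rw [IsFreeGroup.lift_of, if_pos rfl]

/-- Iterating an agreement of conjugations (private helper): if `a * k * a⁻¹ = c * k * c⁻¹` for all
`k` in a set `K` stable under conjugation by `c`, then `a^t * k * (a^t)⁻¹ = c^t * k * (c^t)⁻¹` for all
`t : ℕ` and `k ∈ K`. [folklore] -/
private theorem conj_pow_eq_of_conj_eq {G : Type u} [Group G] {K : Set G} {a c : G}
    (hK : ∀ k ∈ K, c * k * c⁻¹ ∈ K)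
    (h : ∀ k ∈ K, a * k * a⁻¹ = c * k * c⁻¹) (t : ℕ) :
    ∀ k ∈ K, a ^ t * k * (a ^ t)⁻¹ = c ^ t * k * (c ^ t)⁻¹ := by
  induction t with
  | zero => intro k _; simp
  | succ t ih =>
    intro k hk
    have hk' : c * k * c⁻¹ ∈ K := hK k hk
    calc a ^ (t + 1) * k * (a ^ (t + 1))⁻¹
        = a ^ t * (a * k * a⁻¹) * (a ^ t)⁻¹ := by rw [pow_succ']; group
      _ = a ^ t * (c * k * c⁻¹) * (a ^ t)⁻¹ := by rw [h k hk]
      _ = c ^ t * (c * k * c⁻¹) * (c ^ t)⁻¹ := ih _ hk'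
      _ = c ^ (t + 1) * k * (c ^ (t + 1))⁻¹ := by rw [pow_succ']; group

/-- **Main theorem: `C_{M̂}(η Λ) = 1` for a free normal subgroup `Λ` of finite index with
`C_M(Λ) = 1`.**  Let `M` be a group, `Λ ⊴ M` normal of finite index and free (as an abstract group),
with `Subgroup.centralizer Λ = ⊥`.  Then every element of the profinite completion `M̂` commuting with
`η(λ)` for all `λ ∈ Λ` is trivial.  (For `Λ̄ ≤ PSL₂(ℝ)` torsion-free with a cusp and `M = N(Λ̄)`: the
"slimness of `Π_{[X/Aut X]}`" input of [AbsTopIII] Prop. 4.2 (i), p. 106, in the centraliser form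
consumed by abc-iut-L4-t14.)  See the module docstring for the argument.
[cite: MochizukiAbsTopIII2015, Proposition 4.2 (i) proof p.106] -/
theorem eq_one_of_forall_commute_toCompletion (Λ : Subgroup M) [Λ.Normal] [Λ.FiniteIndex]
    [IsFreeGroup Λ] (hC : Subgroup.centralizer (Λ : Set M) = ⊥)
    (y : profiniteCompletion M)
    (hy : ∀ l ∈ Λ, y * toCompletion M l = toCompletion M l * y) : y = 1 := by
  classical
  -- notation: the projection `π : M̂ → M ⧸ Λ` and the closure `K` of `η(Λ)` (`= Ker π`)
  set NΛ : FiniteIndexNormalSubgroup M := FiniteIndexNormalSubgroup.ofSubgroup Λ with hNΛ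
  let π : profiniteCompletion M →* M ⧸ Λ :=
    MonoidHom.mk' (fun w => (w.val NΛ : M ⧸ Λ)) fun _ _ => rfl
  have hπη : ∀ g : M, π (toCompletion M g) = QuotientGroup.mk g := fun g => rfl
  set K : Set (profiniteCompletion M) := closure (toCompletion M '' (Λ : Set M)) with hKdef
  have hKiff : ∀ w : profiniteCompletion M, w ∈ K ↔ π w = 1 :=
    fun w => mem_closure_image_iff_val_eq_one Λ w
  have hKmul : ∀ w₁ ∈ K, ∀ w₂ ∈ K, w₁ * w₂ ∈ K := fun w₁ h₁ w₂ h₂ => by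
    rw [hKiff] at h₁ h₂ ⊢
    rw [map_mul, h₁, h₂, one_mul]
  have hKinv : ∀ w ∈ K, w⁻¹ ∈ K := fun w h => by
    rw [hKiff] at h ⊢
    rw [map_inv, h, inv_one]
  have hKη : ∀ l ∈ Λ, toCompletion M l ∈ K := fun l hl => subset_closure ⟨l, hl, rfl⟩
  -- `η(g)⁻¹ * w ∈ K` as soon as `π w = g·Λ`
  have hmemK : ∀ (g : M) (w : profiniteCompletion M),
      π w = QuotientGroup.mk g → (toCompletion M g)⁻¹ * w ∈ K := fun g w hw => by
    rw [hKiff, map_mul, map_inv, hπη, hw, inv_mul_cancel]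
  -- degenerate case: `Λ` abelian forces `M` trivial (as `C_M(Λ) = 1`), hence `M̂` trivial
  by_cases hab : ∃ a b : Λ, a * b ≠ b * a
  swap
  · push Not at hab
    have hΛbot : ∀ l ∈ Λ, l = 1 := fun l hl => by
      have : l ∈ Subgroup.centralizer (Λ : Set M) := by
        rw [Subgroup.mem_centralizer_iff]
        intro l' hl'
        exact congrArg Subtype.val (hab ⟨l', hl'⟩ ⟨l, hl⟩)
      rwa [hC, Subgroup.mem_bot] at this
    have hM : ∀ g : M, g = 1 := fun g => by
      have : g ∈ Subgroup.centralizer (Λ : Set M) := by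
        rw [Subgroup.mem_centralizer_iff]
        intro l' hl'
        rw [hΛbot l' hl', one_mul, mul_one]
      rwa [hC, Subgroup.mem_bot] at this
    apply Subtype.ext
    funext N
    obtain ⟨g, hg⟩ := QuotientGroup.mk_surjective (y.val N)
    rw [← hg, hM g]
    rfl
  -- `Z(η Λ) ∩ K = 1`
  have hKC : ∀ w : profiniteCompletion M, (∀ l ∈ Λ, w * toCompletion M l = toCompletion M l * w) →
      w ∈ K → w = 1 :=
    fun w hw hwK => eq_one_of_mem_closure_of_forall_commute Λ hab hwK hw
  -- Step 0: `y = η(m) · k₀` with `k₀ ∈ K`, i.e. `π y = m·Λ`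
  obtain ⟨m, hk₀⟩ := exists_inv_mul_mem_closure Λ y
  have hyval : π y = QuotientGroup.mk m := by
    have h0 := (hKiff _).mp hk₀
    rw [map_mul, map_inv, hπη, inv_mul_eq_one] at h0
    exact h0.symm
  -- Case `m ∈ Λ`: then `y ∈ K`, hence `y = 1`
  by_cases hm : m ∈ Λ
  · refine hKC y hy ((hKiff y).mpr ?_)
    rw [hyval]
    exact (QuotientGroup.eq_one_iff m).mpr hm
  exfalso
  -- Step 1: the order `o` of `m` modulo `Λ`; `y ^ o = 1`
  set o : ℕ := orderOf (QuotientGroup.mk m : M ⧸ Λ) with ho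
  have hopos : 0 < o := orderOf_pos _
  haveI : NeZero o := ⟨hopos.ne'⟩
  have hypow : ∀ (t : ℕ), ∀ l ∈ Λ, y ^ t * toCompletion M l = toCompletion M l * y ^ t :=
    fun t l hl => ((show Commute y (toCompletion M l) from hy l hl).pow_left t).eq
  have hyo : y ^ o = 1 := by
    refine hKC _ (hypow o) ((hKiff _).mpr ?_)
    rw [map_pow, hyval, ho, pow_orderOf_eq_one]
  -- Step 2: a basis element `x ∈ Λ`: `C_Λ(x) = ⟨x⟩`, and `f : Λ → ℤ/o` with `f x = 1`
  have hΛne : ∃ g : Λ, g ≠ 1 := by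
    obtain ⟨a0, b0, hab0⟩ := hab
    by_contra hall
    push Not at hall
    exact hab0 (by rw [hall a0, hall b0])
  obtain ⟨x, hxC, f, hfx⟩ := exists_basis_element (Λ : Type u) hΛne o
  -- Step 3: the centraliser condition — `y = η(a) · k` with `a ∈ C_M(x)`, `a ≡ m (mod Λ)`, `k ∈ K`
  have hyx : y ∈ (Subgroup.centralizer ({toCompletion M (x : M)} : Set (profiniteCompletion M)) :
      Set (profiniteCompletion M)) := by
    rw [SetLike.mem_coe, Subgroup.mem_centralizer_iff]
    intro w hw
    rw [Set.mem_singleton_iff] at hw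
    rw [hw]
    exact (hy x x.2).symm
  rw [centralizer_toCompletion_eq_closure_of_isFreeGroup' Λ ‹IsFreeGroup Λ› x.2] at hyx
  obtain ⟨a, haC, hax⟩ := val_mem_map_of_mem_closure hyx NΛ
  have hax' : (QuotientGroup.mk a : M ⧸ Λ) = QuotientGroup.mk m := by
    rw [← hyval]; exact hax
  have haxc : Commute a (x : M) := by
    rw [SetLike.mem_coe, Subgroup.mem_centralizer_iff] at haC
    exact (haC (x : M) (Set.mem_singleton _)).symm
  set k : profiniteCompletion M := (toCompletion M a)⁻¹ * y with hkdef
  have hkK : k ∈ K := hmemK a y (by rw [hax', hyval])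
  have hyk : y * k = k * y := commute_of_mem_closure hy hkK
  have hya : y = toCompletion M a * k := by rw [hkdef, mul_inv_cancel_left]
  have hak : Commute (toCompletion M a) k := by
    have e1 : toCompletion M a = y * k⁻¹ := by rw [hya, mul_inv_cancel_right]
    change toCompletion M a * k = k * toCompletion M a
    rw [e1, inv_mul_cancel_right, ← mul_assoc, ← hyk, mul_inv_cancel_right]
  -- Step 4: `k ^ o = η(a ^ o)⁻¹` and `a ^ o = x ^ j`
  have hko : k ^ o = (toCompletion M (a ^ o))⁻¹ := by
    have e1 : (toCompletion M a) ^ o * k ^ o = 1 := by rw [← hak.mul_pow, ← hya, hyo]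
    rw [map_pow]
    exact eq_inv_of_mul_eq_one_right e1
  have haoΛ : a ^ o ∈ Λ := by
    rw [← QuotientGroup.eq_one_iff, QuotientGroup.mk_pow, hax', ho, pow_orderOf_eq_one]
  have haoC : (⟨a ^ o, haoΛ⟩ : Λ) ∈ Subgroup.centralizer ({x} : Set Λ) := by
    rw [Subgroup.mem_centralizer_iff]
    intro w hw
    rw [Set.mem_singleton_iff] at hw
    subst hw
    exact Subtype.ext ((haxc.symm.pow_right o).eq)
  rw [hxC, Subgroup.mem_zpowers_iff] at haoC
  obtain ⟨j, hj⟩ := haoC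
  have hj' : (x : M) ^ j = a ^ o := by
    have := congrArg Subtype.val hj
    simpa using this
  -- Step 5: `o ∣ j`, by reading `k ^ o = η(x ^ (-j))` through `f̂ : Λ̂ → ℤ/o`
  have hkoj : k ^ o = toCompletion M ((x ^ (-j) : Λ) : M) := by
    rw [hko, ← map_inv, Subgroup.coe_zpow, zpow_neg, hj']
  obtain ⟨q, hq⟩ := exists_pow_eq_of_mem_closure_of_pow_eq Λ f hkK (x ^ (-j)).2 hkoj
  have hqo : q ^ o = 1 := by
    have : Multiplicative.toAdd (q ^ o) = 0 := by
      rw [toAdd_pow, nsmul_eq_mul, ZMod.natCast_self, zero_mul]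
    exact toAdd_eq_zero.mp this
  have hfxj : f (x ^ (-j)) = Multiplicative.ofAdd ((-j : ℤ) : ZMod o) := by
    rw [map_zpow, hfx, ← ofAdd_zsmul, zsmul_eq_mul, mul_one]
  have hdvd : (o : ℤ) ∣ j := by
    have e1 : ((-j : ℤ) : ZMod o) = 0 := by
      have e2 : Multiplicative.ofAdd ((-j : ℤ) : ZMod o) = 1 := by rw [← hfxj, ← hq, hqo]
      exact ofAdd_eq_one.mp e2
    exact dvd_neg.mp ((ZMod.intCast_zmod_eq_zero_iff_dvd (-j) o).mp e1)
  obtain ⟨j', rfl⟩ := hdvd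
  -- Step 6: the element `e := a * x ^ (-j')` has `e ^ o = 1` and `e ≡ m (mod Λ)`, so `e ∉ Λ`
  set e : M := a * (x : M) ^ (-j') with hedef
  have heo : e ^ o = 1 := by
    have h1 : a ^ o = (x : M) ^ ((o : ℤ) * j') := hj'.symm
    have h2 : ((x : M) ^ (-j')) ^ o = (x : M) ^ (-((o : ℤ) * j')) := by
      rw [← zpow_natCast, ← zpow_mul]; congr 1; ring
    rw [hedef, (haxc.zpow_right (-j')).mul_pow, h1, h2, ← zpow_add, add_neg_cancel, zpow_zero]
  have hea : (QuotientGroup.mk e : M ⧸ Λ) = QuotientGroup.mk m := by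
    rw [← hax', hedef, QuotientGroup.mk_mul,
      (QuotientGroup.eq_one_iff _).mpr (Λ.zpow_mem x.2 (-j')), mul_one]
  have henot : e ∉ Λ := fun he => hm (by
    rw [← QuotientGroup.eq_one_iff, ← hea, QuotientGroup.eq_one_iff]; exact he)
  -- Step 7: `y = η(e) · k'`; conjugation by `η(e)` agrees with conjugation by `k'⁻¹` on `K`
  set k' : profiniteCompletion M := (toCompletion M e)⁻¹ * y with hk'def
  have hk'K : k' ∈ K := hmemK e y (by rw [hyval, hea])
  have hye : toCompletion M e = y * k'⁻¹ := by
    rw [hk'def, mul_inv_rev, inv_inv, mul_inv_cancel_left]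
  have hconj : ∀ w ∈ K, toCompletion M e * w * (toCompletion M e)⁻¹ = k'⁻¹ * w * k'⁻¹⁻¹ := by
    intro w hw
    have hw' : k'⁻¹ * w * k' ∈ K := hKmul _ (hKmul _ (hKinv _ hk'K) _ hw) _ hk'K
    have e2 : y * (k'⁻¹ * w * k') = (k'⁻¹ * w * k') * y := commute_of_mem_closure hy hw'
    rw [hye, inv_inv]
    calc y * k'⁻¹ * w * (y * k'⁻¹)⁻¹ = y * (k'⁻¹ * w * k') * y⁻¹ := by group
      _ = k'⁻¹ * w * k' := by rw [e2, mul_inv_cancel_right]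
  have hiter := conj_pow_eq_of_conj_eq (K := K) (a := toCompletion M e) (c := k'⁻¹)
    (fun w hw => hKmul _ (hKmul _ (hKinv _ hk'K) _ hw) _ (hKinv _ (hKinv _ hk'K))) hconj o
  -- `η(e) ^ o = 1`, so `(k'⁻¹) ^ o` commutes with `K`, hence is trivial, hence `k' = 1`
  have heo' : (toCompletion M e) ^ o = 1 := by rw [← map_pow, heo, map_one]
  have hc : (k'⁻¹) ^ o = 1 := by
    refine hKC _ (fun l hl => ?_) ?_
    · have := hiter (toCompletion M l) (hKη l hl)
      rw [heo', one_mul, inv_one, mul_one] at this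
      -- `this : η l = c ^ o * η l * (c ^ o)⁻¹`
      calc (k'⁻¹) ^ o * toCompletion M l
          = (k'⁻¹) ^ o * toCompletion M l * ((k'⁻¹) ^ o)⁻¹ * (k'⁻¹) ^ o := by group
        _ = toCompletion M l * (k'⁻¹) ^ o := by rw [← this]
    · rw [hKiff, map_pow, (hKiff _).mp (hKinv _ hk'K), one_pow]
  have hk'1 : k' = 1 := by
    have := eq_one_of_mem_closure_of_pow_eq_one Λ (hKinv _ hk'K) hopos hc
    rwa [inv_eq_one] at this
  -- hence `η(e) = y` centralises `η(Λ)`, i.e. `e ∈ C_M(Λ) = 1`: contradiction with `e ∉ Λ`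
  have hye' : toCompletion M e = y := by rw [hye, hk'1, inv_one, mul_one]
  have heC : e ∈ Subgroup.centralizer (Λ : Set M) := by
    rw [Subgroup.mem_centralizer_iff]
    intro l hl
    have hcomm : e * l * e⁻¹ * l⁻¹ ∈ Λ := Λ.mul_mem (‹Λ.Normal›.conj_mem l hl e) (Λ.inv_mem hl)
    have h1 : toCompletion M (e * l * e⁻¹ * l⁻¹) = 1 := by
      rw [map_mul, map_mul, map_mul, map_inv, map_inv, hye', hy l hl]
      group
    have h2 := eq_one_of_toCompletion_eq_one Λ hcomm h1
    calc l * e = (e * l * e⁻¹ * l⁻¹)⁻¹ * (e * l) := by group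
      _ = e * l := by rw [h2, inv_one, one_mul]
  rw [hC, Subgroup.mem_bot] at heC
  exact henot (heC ▸ Λ.one_mem)

end FreeNormal

end Literature.GroupTheory

end
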